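import Mathlib
import HarnessLib
import HarnessLib.Audit
import Summits.NavierStokesRegularity.Statement
import Literature.Analysis.FluidPDE.ClassicalSolution
import Literature.Analysis.FluidPDE.LerayHopf
import Literature.Analysis.FluidPDE.SuitableWeak
import Literature.Analysis.FluidPDE.SelfSimilar
import Literature.Analysis.FluidPDE.VectorCalculus
import Literature.Analysis.FluidPDE.NSWave0
import Summits.NavierStokesRegularity.NavierStokesRegularity.Theorems.TypeICertificateLadderNoBlowupToClay
import HarnessLib.Audit.Status.Attr

/-!
Route: ThreadingFlux

THESIS X (card NavierStokesRegularity/NavierStokesRegularity/threading-flux-trace-topology). It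
suffices to show:
(X) NO TYPE-I BLOW-UP for finite-energy classical solutions from Clay data — for every ν>0, every
classical solution (u,p) of
unforced NS on ℝ³×[0,T) which is Leray–Hopf from a rapidly decaying datum and obeys the Type-I rate
‖u(t)‖∞ ≤ C(T−t)^{-1/2}
extends smoothly past T — SPLIT BY THE THREADING OF THE PUTATIVE SINGULARITY, together with the
shared crux NoTypeII
(stmt-NavierStokesRegularity-0056 of route TypeILiouville).
Threading functional (inline in every signature, no new definition needed): for a point x₀, a radius
r and a time t<T,
  Φ(x₀,r,t) := r⁻¹ ∫_{B_r(x₀)} |⟨x−x₀, curl u(t)(x)⟩| / ‖x−x₀‖ dx      (radial vorticity flux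
through small spheres; dimension of ν).
x₀ is UNTHREADED iff ∀ε>0, eventually as r→0⁺, eventually as t→T⁻, Φ(x₀,r,t) ≤ ε; THREADED
otherwise. For an exactly
self-similar blow-up u=(T−t)^{-1/2}U((x−x₀)/√(ν(T−t))) with Ω=curl U ~ |y|^{-2}Ψ(ŷ) at infinity,
limsup_{t→T}Φ = ν∫_{S²}|Ψ_r| = 2νF,
F = the card's threading flux of the (−2)-homogeneous trace ω(·,T); axisymmetric NO-SWIRL data are
unthreaded at every axis
point (ω = ω_θe_θ is tangent to spheres about axis points), Landau-type traces are unthreaded,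
tube/tornado collapses are threaded.
X = UnthreadedNoBlowup ∧ ThreadedNoBlowup, where
  UnthreadedNoBlowup (crux, rank 2): Type-I rate ∧ every x₀ unthreaded ⇒ smooth extension past T
("unthreaded Type I is
    no-swirl in disguise": the symmetry-free half with a proved axisymmetric instance, KNSS2009 Thm
5.2 = in-tree
    knss_axisymmetric_no_swirl'_holds, and SereginSverak2009 Thm 1.1);
  ThreadedNoBlowup (crux, rank 3): Type-I rate ∧ some x₀ threaded ⇒ smooth extension past T (the
nozzle half; its
    hypothesis is the literal negation of the unthreaded clause, so X follows from the two by
excluded middle).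
Lean, one line (elaborates; decl Target of the route file):
  ∀ (ν T : ℝ), 0 < ν → 0 < T → ∀ u p, Literature.Analysis.FluidPDE.IsClassicalNSSolutionOn (Set.Ico
0 T) ν 0 u p →
  Literature.Analysis.FluidPDE.IsLerayHopfOn T ν 0 (u 0) u →
Literature.Analysis.FluidPDE.HasRapidSpatialDecay (u 0) →
  Literature.Analysis.FluidPDE.IsTypeIBlowup u T →
Literature.Analysis.FluidPDE.HasSmoothExtensionPast ν 0 u T
Assembly (pure logic, checked sorry-free in the planner's Sketch.lean): UnthreadedNoBlowup →
ThreadedNoBlowup → NoTypeII →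
NoBlowupToClay (= stmt-NavierStokesRegularity-0055) → NavierStokesRegularity: a classical Leray–Hopf
solution from Clay data
either extends past T or is maximal (IsMaximalSmoothSolution := classical ∧ ¬extends), hence Type I
by NoTypeII, hence extends by
the threading dichotomy — so NoBlowup, and 0055 gives Clay (A).

Rationale: WHY THIS LINE. Blow-up analysis à la geometric flows, but the singularity model is classified by
TOPOLOGY, not by rate or norm:
at a Type-I point the late-time vorticity near x₀ is (asymptotically, or along DSS phases)
(−2)-homogeneous, ω ≈ |x−x₀|⁻²Ψ(θ);
div ω = 0 puts every vortex line of the trace on a cone {χ = c} (χ a stream function on S²,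
H¹(S²)=0) along which it spirals
in or out of x₀ by the sign of the radial part Ψ_r, whose sphere mean vanishes (support
ConeStructure). The one-signed radial
flux F = ∫(Ψ_r)₊ — measured robustly, without any homogeneity, by Φ(x₀,r,t) above — is a SIGNED,
CRITICAL (dimension ν)
invariant of the singular point: F = 0 ('unthreaded': lines are closed loops on shells, the portrait
of every axisymmetric
no-swirl and Landau field) versus F > 0 ('threaded': a nozzle, lines pass through the parabolic
core; Hou's tornado, Kerr/Kida–Pelz
collapses). Helmholtz: vorticity grows only by lengthening lines; loops shrinking onto x₀ shorten
(|ω| ∝ ℓ → 0 for a material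
tube), the mechanism behind η = ω_θ/r (Ukhovskii–Yudovich; KNSS2009 Thm 5.2) stated without symmetry
— hence crux #2; in the
threaded portrait Kelvin fixes the flux of the threading tubes while Type-I compression acts, the
conjectured signed
circulation/strain budget around the cycle in-cone → core → out-cone → far field — crux #3 (a
sketch; most of (L)).
Imported areas: Poincaré compactification / Hodge on S² (dynamical systems), Liouville rigidity for
ancient solutions (KNSS2009
§§5–6, SereginSverak2009, AlbrittonBarker2019), vortex-line transport (Kelvin/Helmholtz/Ertel). No
probabilistic or spectral
reformulation: none sees the sign of x̂·ω. Sources: KNSS2009 (arXiv:0709.3599) Thms 5.2–5.3, Prop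
6.1; SereginSverak2009 Thm 1.1;
AlbrittonBarker2019 Thm 1.1; LeiZhang2017 (arXiv:1505.02628) Thm 1.4 + Wei arXiv:1508.03318
(axisymmetric regularity under SMALL
sup|r v^θ| near the axis; r v^θ = (2π)⁻¹ × vortex flux through the disc = the axisymmetric threading
circulation; smallness data-dependent);
Chae2007; Li–Li–Yan arXiv:1609.08197, arXiv:2410.11170 ((−1)-homogeneous steady NS singular on
rays); Hou2022PotentiallySingularNS.
RANKED CRUXES. #2 UnthreadedNoBlowup (hardest informative step with a proved model case:
symmetry-free no-swirl exclusion at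
Type-I rate). #3 ThreadedNoBlowup (nozzle exclusion; = X minus #2; honest: a sketch only). #4
NoTypeII (shared stmt-0056; its
refutation is ¬Clay(A)). SUPPORT (rank 9, anyone idle): ThreadingFloor (∃ε₀(M)>0: Φ ≤ ε₀ν at every
point ⇒ no Type-I blow-up
with constant M; implies #2, proved in Sketch.lean; the quantitative form the numerics can probe:
F/ν from Hou's profile);
ConeStructure (T1 of the card, provable now: zero-mean radial flux + cone Hamiltonian χ for curl of
a (−1)-homogeneous field);
PoloidalLiouville (bounded ancient mild solutions whose vorticity is tangent to spheres about a
fixed centre at all times are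
slice-wise constant — the Liouville-class kernel of #2; contains the PROVED cone fact
knss_axisymmetric_no_swirl'_holds, since
no-swirl ⇔ purely poloidal in the axisymmetric Mie decomposition; cheapest place for a refuter to
kill the slogan);
NoBlowupToClay (shared stmt-0055); Target (X, rank 0).
KILL CRITERIA. Any finite-energy Type-I singularity from Schwartz data refutes #2 or #3 and is
¬Clay(A) outright (close
refuted, hand the witness to route Blowup with its nozzle type and F/ν window as design data). A
nontrivial non-axisymmetric
purely poloidal bounded ancient mild solution refutes PoloidalLiouville: #2 survives formally but
its mechanism is dead —
pivot #2 to the quantitative floor restricted to DSS blow-up or close `exhausted`. NoTypeII refuted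
(a Type-II blow-up) ⇒ ¬A,
every positive route closes. NoBlowup (stmt-0054) or Target proved elsewhere moots the route. Cheap
probes (kit, later):
F/ν and the cone portrait (Ψ_r, χ) of Hou's axisymmetric profile (arXiv:2107.06509, r⁻¹∂_r(r u_θ) on
the axis) and of
Kerr/Kida–Pelz snapshots — a near-singular run with F/ν → 0 while vorticity still amplifies is
evidence against #2.
DELIBERATELY NOT DECOMPOSED. Existence/tameness of the trace portrait for general Type-I points
(exact for self-similar, phase-wise
for DSS; general Type I is where cards no-tame-singularity / recurrent-type-i-profiles live) — Φ is
defined without it; the zoom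
bookkeeping inside #2/#3 (KNSS Prop 6.1 with the Type-I bound carried to the limit, drift-pinning of
slice-wise constants, far-field
regularity by CKN); the Ertel/potential-vorticity engine for #2 and the Kelvin-cycle budget for #3
(layer-2 children once a crux
moves); B₃-equivariant 'octahedral nozzle' rules (card mirror-walls-weyl-chamber-equivariant).
NUMBERS: Liouville cases known 3 (KNSS
Thms 5.1–5.3) + axisymmetric bounded-Γ variants (doi:10.1360/n012016-00149,
doi:10.1360/ssm-2020-0179); Type I excluded in axisymmetry for
every C (SereginSverak2009); DSS Type-I Liouville open for λ ≥ λ_*(C) (arXiv:1610.09464 Thm 1.3);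
items at open 9 (3 cruxes, 1 shared).

Novelty: NOVELTY (searched 2026-08-15, this session: zbMATH 'Liouville axially symmetric Navier-Stokes
ancient solutions swirl bounded' (2:
Lei–Zhang–Zhao 2017 doi:10.1360/n012016-00149, Lei–Ren–Zhang 2021 doi:10.1360/ssm-2020-0179 —
axisymmetric bounded-Γ Liouville
theorems), 'criticality axially symmetric Navier-Stokes' (2: LeiZhang2017 arXiv:1505.02628, Wei
arXiv:1508.03318), 'poloidal
Navier-Stokes regularity' (2, numerics in a cylinder, irrelevant), 'vortex lines singularity
Navier-Stokes topology' (0),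
'homogeneous vector field divergence free sphere vortex' (0); lit read arXiv:1505.02628 Thm 1.4 p.4
(smallness of sup|Γ| is
relative to data-dependent M₀, M₁ — even the axisymmetric 'threading floor' is not universal in
print); local searchd, OpenAlex,
S2 and arXiv APIs were unavailable/rate-limited (logged in NOTES.md) — plus the card's audited
searches of the same day (refuter
novelty audit: zbMATH ×3, galaxy bm25 rows, 50-card index) graded new-combination.
Nearest prior art: (a) KNSS2009 = arXiv:0709.3599 Thm 5.2 (no-swirl Liouville via ω_θ/r; in tree and
PROVED:
knss_axisymmetric_no_swirl'_holds) and Thm 5.3, §6 Prop 6.1 (zoom); SereginSverak2009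
arXiv:0804.1803 Thm 1.1 (axisymmetric Type I
excluded); (b) LeiZhang2017 Thm 1.4 / Wei 2016: regularity when sup|r v^θ| near the axis is small —
r v^θ(r,z) = (2π)⁻¹ × flux of ω
through the disc of radius r, i.e. the axisymmetric threading circulation; (c) AlbrittonBarker2019
arXiv:1811.00502 Thm 1.1 and
Chae2007 (Type-I points ↔ Type  [refs: 10.1360/n012016-00149, 10.1360/ssm-2020-0179, 1505.02628, 1508.03318, 0709.3599, 0804.1803, 1811.00502, 1609.08197, 2410.11170, doi:10.1360/n012016-00149, doi:10.1360/ssm-2020-0179, LeiZhang2017, KNSS2009, SereginSverak2009, AlbrittonBarker2019, Chae2007]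

Barriers (technique_class: trace-line-topology threading-flux type-I-exclusion): BARRIERS (catalogue Literature/Barriers/NavierStokesRegularity read: 22 structured entries;
technique_class: trace-line-topology threading-flux type-I-exclusion).
- Literature.Barriers.NavierStokesRegularity.TruncatedDyadicTypeIBlowup: this is THE barrier for the
route (its target is exactly 'no blow-up at the scale-invariant rate'). Not evaded by any size
estimate; the bet is fine structure the truncated/averaged models do not have: the cruxes are stated
through curl u and the pointwise SIGNED radial flux x̂·ω, and the intended proofs run on div ω = 0,
the Lie-transport form of the vorticity equation (Kelvin circulation of threading tubes, Helmholtz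
shortening of closed loops, Ertel-type scalars such as ω_θ/r in the model case) — a scalar
one-mode-per-shell cascade has no vorticity field, no field lines and no sign of x̂·ω, so an
argument of this shape cannot even be formulated there. Honest caveat: ThreadedNoBlowup (#3) is a
sketch, nothing is evaded there yet; UnthreadedNoBlowup (#2) has the model case KNSS Thm 5.2 whose
maximum-principle scalar is precisely such non-transferable structure.
- Literature.Barriers.NavierStokesRegularity.TaoAveragedBlowup: same answer one level up (Tao's
averaged blow-up is Type II, arXiv:1402.0290 p.8, so it does not inhabit X at all; it inhabits
NoTypeII, stmt-0056, whose barrier bookkeeping is recorded on route TypeILiouville: backward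
uniqueness / vorticity geometry, not energy).
- Literature.Barriers.NavierStokesRegularity.TruncatedDyadi

History (route lifecycle, newest last):
- 2026-08-16T04:13:14Z · AUTO-CRUX (backfill): Target — hypotheses of the deciding theorem that nothing in the route derives are cruxes (operator:999:1085951)
- 2026-08-16T16:40:11Z · AUTO-CRUX (backfill): Target — hypotheses of the deciding theorem that nothing in the route derives are cruxes (operator:999:1813213)

sub-problem: NavierStokesRegularity · status: open · opened planner-plancard-NavierStokesRegularity-Navie-e01464d7-0 2026-08-15T10:53:49Z · rev 2 · ledger route-NavierStokesRegularity-ThreadingFlux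
GENERATED by the gate from the ledger (D-0016/17). Provers cite these decls: `theorem foo : Summit.NavierStokesRegularity.NavierStokesRegularity.Theses.ThreadingFlux.<Decl> := …` in Summits/NavierStokesRegularity/NavierStokesRegularity/Theorems/<Name>.lean.
-/

namespace Summit.NavierStokesRegularity.NavierStokesRegularity.Theses.ThreadingFlux

open scoped BigOperators Topology Manifold Classical MeasureTheory ProbabilityTheory Matrix InnerProductSpace ComplexConjugate ContinuousMap
open Filter Set Function TopologicalSpace MeasureTheory

attribute [summit_statement] _root_.NavierStokesRegularity

open Literature.NS

/-- item stmt-NavierStokesRegularity-1217 · crux (kind.auto-crux: conjecture-grade) · rank 0 · open · by planner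
why it might fail: ¬Target = finite-energy Type-I blow-up from Schwartz data (¬Clay A). Type-I exclusion ⇔ Liouville for Type-I ancient mild solutions (AlbrittonBarker2019 Thm 1.1), open beyond axisymmetry (KNSS2009 p.3; SereginSverak2009); self-similar excluded (NRŠ, Tsai1998), λ-DSS only for λ<λ_* (ChaeWolf2017).
sources: SereginSverak2009, KNSS2009, AlbrittonBarker2019, ChaeWolf2017Removing, NecasRuzickaSverak1996, Tsai1998
[target] X = NO TYPE-I BLOW-UP FOR CLAY DATA: a classical solution of unforced NS on ℝ³×[0,T) which
is Leray–Hopf from a rapidly decaying datum and blows up at most at the Type-I rate ‖u(t)‖∞ ≤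
C(T−t)^{-1/2} extends smoothly past T. Equals UnthreadedNoBlowup ∧ ThreadedNoBlowup by excluded
middle on 'every point is unthreaded' (proved in the planner's Sketch.lean: target_of_cruxes); it is
the unconditional conclusion of stmt-NavierStokesRegularity-0058 (route TypeILiouville, which
assumes (L)). With NoTypeII (stmt-0056) it gives NoBlowup (stmt-0054). Card:
threading-flux-trace-topology. -/
@[route_item "route-NavierStokesRegularity-ThreadingFlux", crux]
def Target : Prop :=
  ∀ (ν T : ℝ), 0 < ν → 0 < T → ∀ (u : ℝ → EuclideanSpace ℝ (Fin 3) → EuclideanSpace ℝ (Fin 3)) (p : ℝ → EuclideanSpace ℝ (Fin 3) → ℝ), Literature.Analysis.FluidPDE.IsClassicalNSSolutionOn (Set.Ico 0 T) ν 0 u p → Literature.Analysis.FluidPDE.IsLerayHopfOn T ν 0 (u 0) u → Literature.Analysis.FluidPDE.HasRapidSpatialDecay (u 0) → Literature.Analysis.FluidPDE.IsTypeIBlowup u T → Literature.Analysis.FluidPDE.HasSmoothExtensionPast ν 0 u T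

/-- item stmt-NavierStokesRegularity-1218 · crux · rank 2 · open · by planner
why it might fail: No symmetry-free Type-I exclusion (ancient Liouville open even steady, KNSS2009 p.3; λ-DSS open for λ≥λ_*, ChaeWolf2017Removing). As quantified (r fixed, t→T⁻) 'unthreaded' binds only the time-T trace, not the zoom limit: PoloidalLiouville may not engage; known criteria confine ξ (arXiv:2501.08976).
sources: KNSS2009, SereginSverak2009, ChaeWolf2017Removing, AlbrittonBarker2019, GigaMiura2011, arXiv:2501.08976
[crux] UNTHREADED TYPE-I SINGULARITIES DO NOT OCCUR ('unthreaded Type I is no-swirl in disguise';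
card T3). Hypotheses: classical NS on ℝ³×[0,T), Leray–Hopf from a rapidly decaying datum, Type-I
rate (IsTypeIBlowup u T), and EVERY point x₀ is unthreaded: ∀ε>0, eventually as r→0⁺, eventually as
t→T⁻, Φ(x₀,r,t) := r⁻¹∫_{B_r(x₀)} |⟨x−x₀, curl u(t)(x)⟩|/‖x−x₀‖ dx ≤ ε (radial vorticity flux
through small spheres about x₀, dimension of ν; regular points satisfy it trivially, Φ=O(r³)).
Conclusion: smooth extension past T. Model case PROVED in tree: axisymmetric no-swirl fields are
unthreaded at every axis point (ω=ω_θe_θ ⊥ x−x₀) and knss_axisymmetric_no_swirl'_holds (KNSS2009 Thm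
5.2) + SereginSverak2009 Thm 1.1 exclude them; calibration: for u=(T−t)^{-1/2}U(·/√(ν(T−t))) with
curl U ~ |y|^{-2}Ψ(ŷ), limsup_t Φ = ν∫_{S²}|Ψ_r| (= 2ν × the card's threading flux F). Expected
proof shape: zoom at x₀ (KNSS2009 Prop 6.1 / AlbrittonBarker2019 with the Type-I bound carried
along) to an ancient solution whose blow-down has tangential vorticity, then a symmetry-free
no-swirl Liouville argument (support PoloidalLiouville is its all-time kernel; an Ertel-type
potential vorticity ω·∇ϑ for a cone angle ϑ -/
@[route_item "route-NavierStokesRegularity-ThreadingFlux", crux]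
def UnthreadedNoBlowup : Prop :=
  ∀ (ν T : ℝ), 0 < ν → 0 < T → ∀ (u : ℝ → EuclideanSpace ℝ (Fin 3) → EuclideanSpace ℝ (Fin 3)) (p : ℝ → EuclideanSpace ℝ (Fin 3) → ℝ), Literature.Analysis.FluidPDE.IsClassicalNSSolutionOn (Set.Ico 0 T) ν 0 u p → Literature.Analysis.FluidPDE.IsLerayHopfOn T ν 0 (u 0) u → Literature.Analysis.FluidPDE.HasRapidSpatialDecay (u 0) → Literature.Analysis.FluidPDE.IsTypeIBlowup u T → (∀ x₀ : EuclideanSpace ℝ (Fin 3), ∀ ε : ℝ, 0 < ε → ∀ᶠ r in 𝓝[>] (0 : ℝ), ∀ᶠ t in 𝓝[<] T, r⁻¹ * ∫ x in Metric.ball x₀ r, |inner ℝ (x - x₀) (Literature.Analysis.FluidPDE.curl (u t) x)| / ‖x - x₀‖ ≤ ε) → Literature.Analysis.FluidPDE.HasSmoothExtensionPast ν 0 u T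

/-- item stmt-NavierStokesRegularity-1219 · crux · rank 3 · open · by planner
why it might fail: = Type-I exclusion for all nozzle portraits (Type-I ancient Liouville, AlbrittonBarker2019 Thm 1.1, minus the poloidal case), open beyond axisymmetry (KNSS2009 p.3; SereginSverak2009); λ-DSS tube collapse with λ≥λ_* unexcluded (ChaeWolf2017Removing); Kelvin budget is inviscid, ν=O(1) rescaled.
sources: KNSS2009, SereginSverak2009, AlbrittonBarker2019, ChaeWolf2017Removing, arXiv:2501.08976, arXiv:1609.08197
[crux] THREADED (NOZZLE) TYPE-I SINGULARITIES DO NOT OCCUR (card T4). Same hypotheses as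
UnthreadedNoBlowup but with the LITERAL NEGATION of its unthreaded clause (some x₀ is threaded:
Φ(x₀,r,t) does not become small as t→T⁻ then r→0⁺ — this includes wild/non-tame behaviour,
deliberately), conclusion: smooth extension past T. By excluded middle UnthreadedNoBlowup ∧
ThreadedNoBlowup ⇔ Target. Portrait (support ConeStructure): at a threaded point vortex lines of the
(asymptotically homogeneous) trace enter x₀ along inflow cones {χ=c: D(c)<0} and leave along outflow
cones, carrying one-signed flux F ~ O(1)·ν through the parabolic core (Type-I bookkeeping: |ω| ~
1/(T−t) on the core √(ν(T−t))); in axisymmetry WITH swirl the axis is threaded (ω_z(0,z) = r⁻¹∂_r(r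
u_θ) ≠ 0) and the statement holds (SereginSverak2009 Thm 1.1, KNSS Thm 5.3: the C/r mechanism). Line
of attack named by the card (layer 2, not filed): cone by cone, Kelvin fixes the flux of the
threading tubes while Type-I compression acts on inflow cones (super-Hardy inflow strain, constant
tied to F/ν), outflow cones return the same flux with the opposite stretching sign; conjectured
contradiction = a signed circulation/strain -/
@[route_item "route-NavierStokesRegularity-ThreadingFlux", crux]
def ThreadedNoBlowup : Prop :=
  ∀ (ν T : ℝ), 0 < ν → 0 < T → ∀ (u : ℝ → EuclideanSpace ℝ (Fin 3) → EuclideanSpace ℝ (Fin 3)) (p : ℝ → EuclideanSpace ℝ (Fin 3) → ℝ), Literature.Analysis.FluidPDE.IsClassicalNSSolutionOn (Set.Ico 0 T) ν 0 u p → Literature.Analysis.FluidPDE.IsLerayHopfOn T ν 0 (u 0) u → Literature.Analysis.FluidPDE.HasRapidSpatialDecay (u 0) → Literature.Analysis.FluidPDE.IsTypeIBlowup u T → ¬ (∀ x₀ : EuclideanSpace ℝ (Fin 3), ∀ ε : ℝ, 0 < ε → ∀ᶠ r in 𝓝[>] (0 : ℝ), ∀ᶠ t in 𝓝[<] T, r⁻¹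 * ∫ x in Metric.ball x₀ r, |inner ℝ (x - x₀) (Literature.Analysis.FluidPDE.curl (u t) x)| / ‖x - x₀‖ ≤ ε) → Literature.Analysis.FluidPDE.HasSmoothExtensionPast ν 0 u T

/-- item stmt-NavierStokesRegularity-0056 · crux · rank 4 · open · by planner
why it might fail: Its negation (Type-II blow-up from Schwartz data) is ¬Clay(A). No blow-up rate is bounded above, only below (Leray ε₁/√(T−t); L³↑∞, ESS2003, Seregin2012); axisymmetric singularities are Type II (KNSS2009 p.4), so Hou's arXiv:2107.06509, if singular, refutes it; Tao's averaged blow-up is Type II.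
sources: KNSS2009, Tao2016AveragedNS, Hou2022PotentiallySingularNS, Seregin2012, EscauriazaSereginSverak2003, Seregin2024AxisymTypeII
If a finite-energy classical solution from a rapidly decaying datum has maximal lifespan T<∞ (no
classical extension past T), then ‖u(t)‖_∞ ≤ C (T−t)^{-1/2} eventually as t↑T (Leray's rate is the
matching lower bound, leray_blowup_rate_top). The hardest and most informative crux: a
counterexample is a Type II singularity, i.e. ¬(Clay A). Known: lower bound c√ν (T−t)^{-1/2} (Leray
1934 §20); L³ must blow up (ESS 2003, Seregin 2012); only triple-log quantitative gain (Tao 2021). -/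
@[route_item "route-NavierStokesRegularity-ThreadingFlux", crux]
def NoTypeII : Prop :=
  ∀ (ν T : ℝ), 0 < ν → 0 < T → ∀ (u : ℝ → EuclideanSpace ℝ (Fin 3) → EuclideanSpace ℝ (Fin 3)) (p : ℝ → EuclideanSpace ℝ (Fin 3) → ℝ), Literature.Analysis.FluidPDE.IsMaximalSmoothSolution ν 0 u p T → Literature.Analysis.FluidPDE.IsLerayHopfOn T ν 0 (u 0) u → Literature.Analysis.FluidPDE.HasRapidSpatialDecay (u 0) → Literature.Analysis.FluidPDE.IsTypeIBlowup u T

/-- item stmt-NavierStokesRegularity-0055 · support · rank 9 · closed · proved by Summit.NavierStokesRegularity.NavierStokesRegularity.Theorems.typeICertificateLadder_noBlowupToClay_proof @ 8d57e70af7e2 (prover) · by planner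
sources: Leray1934, Fefferman2000, CKN1982
Given NoBlowup, build the Clay (A) solution: local finite-energy classical solution for smooth
divergence-free rapidly decaying data (Leray 1934 §III / Fujita–Kato 1964 + LPS smoothing), continue
past every T using NoBlowup, glue by weak–strong uniqueness (Prodi–Serrin), bounded energy from the
energy inequality, and convert with
Literature.Analysis.FluidPDE.isNavierStokesSolution_and_smooth_iff. Blow-up at spatial infinity is
excluded by CKN ε-regularity applied far out. May take named Literature facts (leray_existence_R3,
ladyzhenskaya_prodi_serrin, weak_strong_uniqueness, fujita_kato_local) as hypotheses if the grounder
so rules. -/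
@[route_item "route-NavierStokesRegularity-ThreadingFlux", crux]
def NoBlowupToClay : Prop :=
  (∀ (ν T : ℝ), 0 < ν → 0 < T → ∀ (u : ℝ → EuclideanSpace ℝ (Fin 3) → EuclideanSpace ℝ (Fin 3)) (p : ℝ → EuclideanSpace ℝ (Fin 3) → ℝ), Literature.Analysis.FluidPDE.IsClassicalNSSolutionOn (Set.Ico 0 T) ν 0 u p → Literature.Analysis.FluidPDE.IsLerayHopfOn T ν 0 (u 0) u → Literature.Analysis.FluidPDE.HasRapidSpatialDecay (u 0) → Literature.Analysis.FluidPDE.HasSmoothExtensionPast ν 0 u T) → NavierStokesRegularity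

/-- `NoBlowupToClay` holds: proved by `Summit.NavierStokesRegularity.NavierStokesRegularity.Theorems.typeICertificateLadder_noBlowupToClay_proof` @ 8d57e70af7e2. -/
theorem NoBlowupToClay_holds : NoBlowupToClay := _root_.Summit.NavierStokesRegularity.NavierStokesRegularity.Theorems.typeICertificateLadder_noBlowupToClay_proof

/-- item stmt-NavierStokesRegularity-1220 · support · rank 9 · open · by planner
why it might fail: Stronger than UnthreadedNoBlowup: Type-I nozzles with arbitrarily small flux F/ν might exist (cf. DSS profiles only excluded for λ<λ_*(C), Chae–Wolf arXiv:1610.09464); even in axisymmetry the printed small-swirl constant depends on the data (LeiZhang2017 Thm 1.4).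
sources: LeiZhang2017, arXiv:1508.03318, arXiv:1610.09464, KNSS2009
[support] THREADING FLOOR (quantitative unthreaded exclusion; card T3 quantitative form): for every
dimensionless Type-I constant M there is ε₀(M)>0 such that a classical Leray–Hopf solution from a
rapidly decaying datum with ‖u(t,x)‖ ≤ M√(ν/(T−t)) near T and Φ(x₀,r,t) ≤ ε₀ν eventually (r→0⁺, then
t→T⁻) at EVERY x₀ extends smoothly past T; i.e. F/ν ∈ [ε₀(M), C(M)] for every genuine Type-I
singularity. Implies UnthreadedNoBlowup (floor_implies_unthreaded, proved in the planner's
Sketch.lean). Axisymmetric analogue in print: regularity when sup|r v^θ| is small near the axis, r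
v^θ(r,z) = (2π)⁻¹ × flux of ω through the disc (LeiZhang2017 Thm 1.4 — smallness relative to
data-dependent M₀,M₁ — and Wei arXiv:1508.03318); note that in axisymmetry the Type-I class is empty
anyway (SereginSverak2009). Natural ε-regularity form for provers: small scale-invariant radial flux
at all small scales near (x₀,T) + Type-I bound ⇒ (x₀,T) regular. Numerics hook: F/ν of Hou's profile
from r⁻¹∂_r(r u_θ) on the axis (arXiv:2107.06509). -/
@[route_item "route-NavierStokesRegularity-ThreadingFlux", crux]
def ThreadingFloor : Prop :=
  ∀ M : ℝ, ∃ ε₀ : ℝ, 0 < ε₀ ∧ ∀ (ν T : ℝ), 0 < ν → 0 < T → ∀ (u : ℝ → EuclideanSpace ℝ (Fin 3) → EuclideanSpace ℝ (Fin 3)) (p : ℝ → EuclideanSpace ℝ (Fin 3) → ℝ), Literature.Analysis.FluidPDE.IsClassicalNSSolutionOn (Set.Ico 0 T) ν 0 u p → Literature.Analysis.FluidPDE.IsLerayHopfOn T ν 0 (u 0) u → Literature.Analysis.FluidPDE.HasRapidSpatialDecay (u 0) → (∀ᶠ t in 𝓝[<] T, ∀ x, ‖u t x‖ ≤ M * Real.sqrt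 (ν / (T - t))) → (∀ x₀ : EuclideanSpace ℝ (Fin 3), ∀ᶠ r in 𝓝[>] (0 : ℝ), ∀ᶠ t in 𝓝[<] T, r⁻¹ * ∫ x in Metric.ball x₀ r, |inner ℝ (x - x₀) (Literature.Analysis.FluidPDE.curl (u t) x)| / ‖x - x₀‖ ≤ ε₀ * ν) → Literature.Analysis.FluidPDE.HasSmoothExtensionPast ν 0 u T

/-- item stmt-NavierStokesRegularity-1221 · support · rank 9 · closed · proved by Summit.NavierStokesRegularity.NavierStokesRegularity.Theorems.threadingFlux_coneStructure_proof (prover) · by planner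
sources: MajdaBertozzi2002, Chae2007, arXiv:1609.08197
[support] CONE STRUCTURE OF A HOMOGENEOUS TRACE (card T1; true, provable now, some Lean work): for U
smooth on ℝ³∖{0} and (−1)-homogeneous (U(cx) = c⁻¹U(x)), ω = curl U is (−2)-homogeneous and (i) its
radial part has zero mean: ∫_{B₁} ⟨x, ω(x)⟩/‖x‖ dx = 0 (= ∫_0^1 dρ ∮_{S²}Ψ_r = flux of a curl
through the unit sphere, Stokes on a closed surface — NOT a consequence of div ω = 0 on ℝ³∖{0}
alone: x/|x|³); (ii) the tangential part is a sphere-curl: there is a 0-homogeneous χ, C¹ on ℝ³∖{0},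
with ω(x) − (⟨x,ω(x)⟩/‖x‖²)x = ‖x‖⁻² · x × ∇χ(x) (on S²: Ψ_tan = n × ∇_{S²}χ, which exists because
div_{S²}Ψ_tan = 0 follows from div ω = 0 and (−2)-homogeneity, and H¹(S²) = 0; sign of χ free).
Consequences used by the cruxes (informal): ⟨ω, ∇χ⟩ = 0, so every vortex line lies on a cone {χ =
c}; in the time dτ = |x|⁻³dt, dθ/dτ = n×∇χ, d log|x|/dτ = Ψ_r, so on a cone with closed χ-orbit the
line gains D(c) = ∮Ψ_r dτ in log|x| per turn (spirals in, out, or closes up), critical points of χ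
give radial lines, and area-preservation of the χ-flow gives ∫D(c)dc = ∫_{S²}Ψ_r = 0: inflow and
outflow cones carry equal flux F = ∫(Ψ_r)₊. Lean route for (ii): build χ by integrating the closed
1-form ⋆Ψ_tan♭ on the -/
@[route_item "route-NavierStokesRegularity-ThreadingFlux", crux]
def ConeStructure : Prop :=
  ∀ U : EuclideanSpace ℝ (Fin 3) → EuclideanSpace ℝ (Fin 3), ContDiffOn ℝ (⊤ : ℕ∞) U {0}ᶜ → (∀ x : EuclideanSpace ℝ (Fin 3), x ≠ 0 → ∀ c : ℝ, 0 < c → U (c • x) = c⁻¹ • U x) → (∫ x in Metric.ball (0 : EuclideanSpace ℝ (Fin 3)) 1, inner ℝ x (Literature.Analysis.FluidPDE.curl U x) / ‖x‖ = 0) ∧ ∃ χ : EuclideanSpace ℝ (Fin 3) → ℝ, ContDiffOn ℝ 1 χ {0}ᶜ ∧ (∀ x : EuclideanSpace ℝ (Fin 3), x ≠ 0 → ∀ c : ℝ, 0 < c → χ (c • x) = χ x) ∧ ∀ x : EuclideanSpace ℝ (Fin 3), x ≠ 0 → Literature.Analysis.FluidPDE.curl U x - (inner ℝ x (Literature.Analysis.FluidPDE.curl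 U x) / ‖x‖ ^ 2) • x = (‖x‖ ^ 2)⁻¹ • Literature.Analysis.FluidPDE.cross x (gradient χ x)

-- `ConeStructure` holds: proved by `Summit.NavierStokesRegularity.NavierStokesRegularity.Theorems.threadingFlux_coneStructure_proof` (its module imports this route file, so no `_holds` link can be stated here).

/-- item stmt-NavierStokesRegularity-1222 · support · rank 9 · open · by planner
why it might fail: A non-axisymmetric bounded ancient (e.g. steady or time-periodic) purely poloidal NS flow would refute it; poloidality is not propagated by NS in general, so the class may also collapse to axisymmetric no-swirl (then it is KNSS Thm 5.2 and merely support).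
sources: KNSS2009, SereginSverak2009, doi:10.1360/n012016-00149, doi:10.1360/ssm-2020-0179
[support] POLOIDAL (SYMMETRY-FREE NO-SWIRL) LIOUVILLE THEOREM — the Liouville-class kernel of
UnthreadedNoBlowup and the cheapest place to test the slogan: a bounded ancient mild solution of NS
(ν=1) on ℝ³×(−∞,0) with measurable slices, smooth on (−∞,0)×ℝ³, whose vorticity is TANGENT TO THE
SPHERES about one fixed centre x₀ at all times (⟨x−x₀, curl v(t)(x)⟩ = 0: v(t) is purely poloidal
w.r.t. x₀ in the Mie/poloidal–toroidal decomposition, x·curl v = −Λ_{S²}(toroidal potential)) is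
spatially constant on every slice (conclusion slice-wise and pointwise, as for
LiouvilleConjectureNS: the duality-form class contains the drifts v = b(t)). CONTAINS A PROVED CONE
FACT: axisymmetric no-swirl ⇔ axisymmetric purely poloidal (ω = ω_θ e_θ ⊥ x − x₀ for x₀ on the
axis), and knss_axisymmetric_no_swirl'_holds (KNSS2009 Thm 5.2, proved in
Literature/Analysis/FluidPDE/KNSSAxisymmetricNoSwirlHolds.lean) is exactly this statement under
IsAxisymmetric ∧ HasNoSwirl. Two ways it can close: RIGIDITY (all-time poloidality about x₀ forces
axisymmetry without swirl about an axis through x₀ — then cite the proved fact), or a symmetry-free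
maximum-principle scalar replacing η = ω_θ/r (Ertel potential vorticit -/
@[route_item "route-NavierStokesRegularity-ThreadingFlux", crux]
def PoloidalLiouville : Prop :=
  ∀ v : ℝ → EuclideanSpace ℝ (Fin 3) → EuclideanSpace ℝ (Fin 3), Literature.Analysis.FluidPDE.IsBoundedAncientMildSolution 1 v → (∀ t < 0, AEStronglyMeasurable (v t) volume) → ContDiffOn ℝ (⊤ : ℕ∞) (Function.uncurry v) (Set.Iio 0 ×ˢ Set.univ) → (∃ x₀ : EuclideanSpace ℝ (Fin 3), ∀ t < 0, ∀ x, inner ℝ (x - x₀) (Literature.Analysis.FluidPDE.curl (v t) x) = 0) → ∀ t < 0, ∃ b : EuclideanSpace ℝ (Fin 3), ∀ x, v t x = b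

/-- item stmt-NavierStokesRegularity-1223 · assembly · rank 1 · closed · proved by Summit.NavierStokesRegularity.NavierStokesRegularity.Theorems.threadingFlux_assembly_proof (prover) · by planner
sources: Fefferman2000, KNSS2009
[assembly] UnthreadedNoBlowup → ThreadedNoBlowup → NoTypeII → NoBlowupToClay →
NavierStokesRegularity (written expanded; `rfl`-equal to the decl-name form and PROVED BY PURE LOGIC
in the planner's Sketch.lean, theorem assembly_holds, ~10 lines): fix ν,T,u,p classical on [0,T),
Leray–Hopf from a rapidly decaying datum; if u had no smooth extension past T it would be a maximal
smooth solution (IsMaximalSmoothSolution := classical ∧ ¬HasSmoothExtensionPast), hence Type I by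
NoTypeII, hence — by cases on 'every x₀ is unthreaded' — extendable by UnthreadedNoBlowup or
ThreadedNoBlowup, contradiction; so NoBlowup holds and NoBlowupToClay (= stmt-0055) yields Clay (A). -/
@[route_item "route-NavierStokesRegularity-ThreadingFlux", crux]
def Assembly : Prop :=
  (∀ (ν T : ℝ), 0 < ν → 0 < T → ∀ (u : ℝ → EuclideanSpace ℝ (Fin 3) → EuclideanSpace ℝ (Fin 3)) (p : ℝ → EuclideanSpace ℝ (Fin 3) → ℝ), Literature.Analysis.FluidPDE.IsClassicalNSSolutionOn (Set.Ico 0 T) ν 0 u p → Literature.Analysis.FluidPDE.IsLerayHopfOn T ν 0 (u 0) u → Literature.Analysis.FluidPDE.HasRapidSpatialDecay (u 0) → Literature.Analysis.FluidPDE.IsTypeIBlowup u T → (∀ x₀ : EuclideanSpace ℝ (Fin 3), ∀ ε : ℝ, 0 < ε → ∀ᶠ r in 𝓝[>] (0 : ℝ), ∀ᶠ t in 𝓝[<] T, r⁻¹ * ∫ x in Metric.ball x₀ r, |inner ℝ (x - x₀) (Literature.Analysis.FluidPDE.curl (u t) x)| / ‖x - x₀‖ ≤ ε) → Literature.Analysis.FluidPDE.HasSmoothExtensionPast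 ν 0 u T) → (∀ (ν T : ℝ), 0 < ν → 0 < T → ∀ (u : ℝ → EuclideanSpace ℝ (Fin 3) → EuclideanSpace ℝ (Fin 3)) (p : ℝ → EuclideanSpace ℝ (Fin 3) → ℝ), Literature.Analysis.FluidPDE.IsClassicalNSSolutionOn (Set.Ico 0 T) ν 0 u p → Literature.Analysis.FluidPDE.IsLerayHopfOn T ν 0 (u 0) u → Literature.Analysis.FluidPDE.HasRapidSpatialDecay (u 0) → Literature.Analysis.FluidPDE.IsTypeIBlowup u T → ¬ (∀ x₀ : EuclideanSpace ℝ (Fin 3), ∀ ε : ℝ, 0 < ε → ∀ᶠ r in 𝓝[>] (0 : ℝ), ∀ᶠ t in 𝓝[<] T, r⁻¹ * ∫ x in Metric.ball x₀ r, |inner ℝ (x - x₀) (Literature.Analysis.FluidPDE.curl (u t) x)| / ‖x - x₀‖ ≤ ε) → Literature.Analysis.FluidPDE.HasSmoothExtensionPast ν 0 u T) → (∀ (ν T : ℝ), 0 < ν → 0 < T → ∀ (u : ℝ → EuclideanSpace ℝ (Fin 3) → EuclideanSpace ℝ (Fin 3)) (p : ℝ → EuclideanSpace ℝ (Fin 3)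 → ℝ), Literature.Analysis.FluidPDE.IsMaximalSmoothSolution ν 0 u p T → Literature.Analysis.FluidPDE.IsLerayHopfOn T ν 0 (u 0) u → Literature.Analysis.FluidPDE.HasRapidSpatialDecay (u 0) → Literature.Analysis.FluidPDE.IsTypeIBlowup u T) → ((∀ (ν T : ℝ), 0 < ν → 0 < T → ∀ (u : ℝ → EuclideanSpace ℝ (Fin 3) → EuclideanSpace ℝ (Fin 3)) (p : ℝ → EuclideanSpace ℝ (Fin 3) → ℝ), Literature.Analysis.FluidPDE.IsClassicalNSSolutionOn (Set.Ico 0 T) ν 0 u p → Literature.Analysis.FluidPDE.IsLerayHopfOn T ν 0 (u 0) u → Literature.Analysis.FluidPDE.HasRapidSpatialDecay (u 0) → Literature.Analysis.FluidPDE.HasSmoothExtensionPast ν 0 u T) → NavierStokesRegularity) → NavierStokesRegularity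

-- `Assembly` holds: proved by `Summit.NavierStokesRegularity.NavierStokesRegularity.Theorems.threadingFlux_assembly_proof` (its module imports this route file, so no `_holds` link can be stated here).

/-! D-0027 §2.1 — DECIDING THEOREM (planner-authored via `route open/edit --closes-file`; by planner-rbadge-NavierStokesRegularity-Threadin-369757ed-g2-0 2026-08-15T16:13:09Z):
its hypotheses are this route's items and its conclusion the sub-problem Statement (glue_lint), and it elaborates with this file. -/

@[closes "route-NavierStokesRegularity-ThreadingFlux"] theorem closes : Target → UnthreadedNoBlowup → ThreadedNoBlowup → NoTypeII → NoBlowupToClay → ThreadingFloor → ConeStructure → PoloidalLiouville → Assembly → _root_.NavierStokesRegularity := by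
  intro hTarget _hUnthreaded _hThreaded hNoTypeII hClay _hFloor _hCone _hPoloidal _hAssembly
  -- NoBlowupToClay reduces Clay (A) to "every classical Leray–Hopf solution from a rapidly
  -- decaying datum extends smoothly past every finite T"; that follows from NoTypeII + Target:
  -- if u did not extend past T it would be a maximal smooth solution, hence Type I (NoTypeII),
  -- hence extendable (Target) — contradiction.
  refine hClay ?_
  intro ν T hν hT u p hcl hlh hdec
  by_contra hnot
  have hmax : Literature.Analysis.FluidPDE.IsMaximalSmoothSolution ν 0 u p T := ⟨hcl, hnot⟩
  exact hnot (hTarget ν T hν hT u p hcl hlh hdec (hNoTypeII ν T hν hT u p hmax hlh hdec))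

end Summit.NavierStokesRegularity.NavierStokesRegularity.Theses.ThreadingFlux
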